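import Summits.QuantumAdvantage.AdviceFreeQNC0.AffBells29Transfer
import HarnessLib

/-!
# Joint-phase certificate — part 1/3: §C.1 shift systems and certificate shape, §C.2 phase counts, §C.3 the engine `wideParity_of_cert`

VERBATIM split (400-line rule) of planner qa-qnc0-p1 g30's `HOME/qa-qnc0-p1/exp30/Cert30.lean` (sha16 `d540ad8703b716ed`, 715 lines = the referee's
pin `Cert30.pre3final.lean`; farm rc 0 / 0 sorry / 0 warnings; authored AND proved by the planner seat; landed by qn-prover-3 g15, ask P-30c) into
`AffBells30Cert.lean` (§C.1–§C.3), `AffBells30Drop.lean` (§C.4–§C.6), `AffBells30Block.lean` (§C.7–§C.8); only file boundaries, per-file preambles,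
these header lines and one-line docstrings on undocumented auxiliaries are new.  NOTE: `HWideE`/`HCert` (§C.6) are labelled REFUTED-AS-TYPED records
by the planner; the live conjectures are `HDrop` (§C.5) ⇐ `HBlock` (§C.7) ⇐ `HPart` (§C.8).  The planner's module docstring follows.

# Cert30 (planner qn-p1 g30, ROUND-29): the JOINT-PHASE CERTIFICATE engine (PROVED), the DROP-SET form `HDrop` of the wide-parity
conjecture (`HDrop → HAbs → (NP₁)` PROVED), and the BLOCK-BALANCE form `HBlock` (`HBlock → HDrop` PROVED)

Context.  The frame-shadow / transfer reduction (`AffBells29Shadow`, `AffBells29Transfer`, tree) leaves ONE conjecture feeding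
`HAbs`: far affine strategies with few coin-pair cut points admit a low-degree competitor for the firing PARITY.  ROUND-29 (this
round) REFUTES every THRESHOLD-defined form of that conjecture (tree `AffBells29.HWide` with the fixed width `C·log₂N`; the
width-existential `HWideE` and the threshold certificate `HCert` of §C.6; `AffBells29.HShape`): sparse-core pure run tilings (lit L-36
own-position designs on random sparse ±1 cores of ANY width `s`, graded over `s ∈ [0, C log N]`) are far, have NO cut points, and violate
`WideParityAt w` at ≈ 50 % of the odd class for every `w` they straddle (R3; numerics K-44p / `grt_check*.py`).  What survives is the
tree's `HAbs` (competitor `z'` FREE): for those tilings `z'` = «drop whole runs» works.  Hence the live forms below let the PLANNER choose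
the set `D` of dropped rows per `(N, β, c)` (whole twin blocks, never a width threshold); the only constraint is that the KEPT rows are
polylog-narrow (so that `readsOnly_shadow`/`bitFn_drop_lowDeg` give the low-degree competitor).

* §C.1–C.3 THE ENGINE (c enters only through `x ∉ cutPoints β c`; radius ONE).  Data at an odd point `x`: a partition `s` of the
  active rows each part inside or disjoint from the designated set `W`, coin pairs `P`, a shift table `δ` with every pair shifting every
  row of a part uniformly (`UniformShift`), and the CERTIFICATE parities (`CertShapeW W β x`: the number of pairs shifting part `k` by `+1`,
  resp. by `−1`, is odd iff `k ⊆ W`).  **`desigParity_of_cert` (PROVED):** `x ∉ cutPoints β c ∧ CertShapeW W β x ⇒ DesigParityAt W β c x`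
  (the rows of `W` fire with parity `≡ |W ∩ act x|`).  Linear-algebra reading: purity at `x` ⟺ the imbalance vector `(A,B)(x)` lies in
  the nullspace of the pair/class incidence matrix `E(x)` over `𝔽₂`; the certificate ⟺ `(𝟙_W,𝟙_W) ∈ rowspace E(x)`.  Census K-44p
  (j317453, 16 families, N ≤ 192, 300 points/cell): the certificate holds at 1.00 of CLEAN points (no class mixing designated and kept
  rows, no coin-poor designated row) in every family from N = 72 on, frames included; it fails exactly at mixed classes and coin-poor rows.
* §C.4–C.5 THE DROP-SET FORM.  `dropRow/dropOff/dropAct/DropParityAt`; `dropParity_of_cert`; **`HDrop`** := far ∧ few cut points ⇒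
  `∃ D` (kept rows of width `≤ (log₂N)^C`) with `DropParityAt D` at all but `ε·2^{N−1}` odd points; **`hAbs_of_hDrop`, `polyLoss_of_hDrop`
  (PROVED)**.  RISK R4 (NESTED-RUN CHAINS, numerics `r4_check.py`): pure runs on nested cores `v₁ ⊂ v₂ ⊂ …` are far and cut-free, `HDrop`
  holds with `D` = the runs above any core-width threshold, but the boundary runs MERGE into one coin class at ≈ 2/3 of the points, where
  no pointwise certificate exists (cert 0.38 vs DropParity 1.00 at N = 96): the certificate is a LEMMA for generic points, not the theorem.
* §C.7 THE BLOCK-BALANCE FORM (the statement the proof architecture of ROUND-29 §6 actually targets).  `BlockBalancedAt L D β c x`: the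
  designated active rows split into parts, each COHERENT (sign-twins on the coins outside a set of ≤ L positions — a common phase) and
  SIGNED-PHASE-BALANCED (its three phase counts have equal parity); **`blockBalanced_dropParity` (PROVED)**; **`HBlock`** := far ∧ few cut
  points ⇒ `∃ D`, block balance a.e.; **`hDrop_of_hBlock`, `polyLoss_of_hBlock` (PROVED)**.  Per-CLASS balance is FALSE for pure non-twin
  designs (lit `nbr2s6`, `s7a`: 0/40, 2/40 points) while whole RUNS are balanced parts — hence parts are coherent blocks, not classes.
* §C.8 THE PART-PARITY FORM `HPart` (the weakest typed target): coherent parts each firing with parity `≡` its size; **`partParity_dropParity`,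
  `blockBalanced_partParity`, `partParity_of_cert` (= the engine, part by part), `hDrop_of_hPart`, `hPart_of_hBlock`, `polyLoss_of_hPart` (PROVED)** — so
  `HBlock → HPart → HDrop → HAbs → (NP₁)`, and a prover may target whichever of the three is most convenient.
* §C.6 RECORD ONLY: `HWideE`, `HCert` (REFUTED AS TYPED, R3) with their true implications, kept so the refutation has a typed referent.

WHAT THIS IS NOT: no claim about the crux `RingDenseResidualLt3`; `HDrop`/`HBlock` are conjectures (typed, unproved); nothing here
touches the route file; separation NOT moved.
-/

noncomputable section

open Classical

namespace Summit.QuantumAdvantage.AdviceFreeQNC0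

namespace AffBells30

open Finset Literature.Computability.QuantumComplexity Literature.Computability.QuantumComplexity.RingHLF
open Literature.Computability.MetaComplexity Literature.Computability.MetaComplexity.Smolensky
open AffBells23 AffBells26 Fib19 AffBells27 AffBells28 AffBells29

variable {N : ℕ}


/-! ### §C.1 Shift systems and the certificate shape (data about `β` and `x` only) -/

/-- A coin pair of `x`: two distinct zeros of the kernel line. -/
def IsCoinPair (x : Fin N → Bool) (p : Fin N × Fin N) : Prop :=
  p.1 ∈ klineZeros x ∧ p.2 ∈ klineZeros x ∧ p.1 ≠ p.2

/-- Flipping the pair `p` shifts the part `k` UNIFORMLY by `δ`: the form of every row of `k` moves by `δ`. -/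
def UniformShift (β : Fin N → Fin N → ZMod 3) (x : Fin N → Bool) (k : Finset (Fin N)) (p : Fin N × Fin N) (δ : ZMod 3) : Prop :=
  ∀ g ∈ k, form β (flipAt x ({p.1, p.2} : Finset (Fin N))) g = form β x g + δ

/-- **`CertShapeW W β x`** — the joint-phase certificate at `x` for a DESIGNATED set `W` of active rows (see the module docstring):
a partition `s` of `act x` into parts each inside or outside `W`, a multiset-free family `P` of coin pairs shifting every part uniformly,
with the numbers of `+1`- and of `−1`-shifts both ODD on the parts inside `W` and both EVEN on the parts outside.  About `β`, `x`, `W` only. -/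
def CertShapeW (W : Finset (Fin N)) (β : Fin N → Fin N → ZMod 3) (x : Fin N → Bool) : Prop :=
  ∃ (s : Finset (Finset (Fin N))) (P : Finset (Fin N × Fin N)) (δ : Finset (Fin N) → Fin N × Fin N → ZMod 3),
    (∀ k ∈ s, ∀ k' ∈ s, k ≠ k' → Disjoint k k') ∧ s.biUnion id = act x ∧
    (∀ k ∈ s, k ⊆ W ∨ Disjoint k W) ∧
    (∀ p ∈ P, IsCoinPair x p) ∧
    (∀ k ∈ s, ∀ p ∈ P, UniformShift β x k p (δ k p)) ∧
    (∀ k ∈ s, ((P.filter fun p => δ k p = 1).card : ZMod 2) = (if k ⊆ W then 1 else 0) ∧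
      ((P.filter fun p => δ k p = 2).card : ZMod 2) = (if k ⊆ W then 1 else 0))

/-- The width-threshold instance (designated set = the wide active rows).  KEPT FOR THE RECORD ONLY: every threshold-defined wide set
is refuted as a route to `(NP₁)` (§C.6, sparse-core run-twin tilings); the live instance is the drop-set one (§C.4). -/
def CertShape (w : ℕ) (β : Fin N → Fin N → ZMod 3) (x : Fin N → Bool) : Prop := CertShapeW (wideAct w β x) β x

/-- **DESIGNATED PARITY at `x`**: the rows of `W` fire with parity `≡ #W`. (`WideParityAt w = DesigParityAt (wideAct w β x)`.) -/
def DesigParityAt (W : Finset (Fin N)) (β : Fin N → Fin N → ZMod 3) (c : Fin N → ZMod 3) (x : Fin N → Bool) : Prop :=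
  fires β c W x % 2 = W.card % 2

/-! ### §C.2 Phase counts and the flip bookkeeping -/

/-- Rows of `k` that would fire after a common form shift `t`. -/
def phaseCount (β : Fin N → Fin N → ZMod 3) (c : Fin N → ZMod 3) (x : Fin N → Bool) (k : Finset (Fin N)) (t : ZMod 3) : ℕ :=
  (k.filter fun g => form β x g + t = c g).card

/-- Auxiliary `phaseCount_zero` of the joint-phase certificate engine (planner qa-qnc0-p1 g30, `Cert30.lean`, verbatim). -/
theorem phaseCount_zero (β : Fin N → Fin N → ZMod 3) (c : Fin N → ZMod 3) (x : Fin N → Bool) (k : Finset (Fin N)) :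
    phaseCount β c x k 0 = fires β c k x := by
  unfold phaseCount fires
  simp only [add_zero]

/-- The three phase counts partition `k`. -/
theorem phaseCount_sum (β : Fin N → Fin N → ZMod 3) (c : Fin N → ZMod 3) (x : Fin N → Bool) (k : Finset (Fin N)) :
    phaseCount β c x k 0 + phaseCount β c x k 1 + phaseCount β c x k 2 = k.card := by
  have key1 : ∀ u v : ZMod 3, (¬ u + 0 = v ∧ u + 1 = v) ↔ u + 1 = v := by decide
  have key2 : ∀ u v : ZMod 3, (¬ u + 0 = v ∧ ¬ u + 1 = v) ↔ u + 2 = v := by decide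
  unfold phaseCount
  rw [← card_filter_add_card_filter_not (s := k) (fun g => form β x g + 0 = c g), add_assoc]
  congr 1
  rw [← card_filter_add_card_filter_not (s := k.filter fun g => ¬ form β x g + 0 = c g) (fun g => form β x g + 1 = c g),
    filter_filter, filter_filter]
  congr 1
  · congr 1; exact filter_congr fun g _ => (key1 _ _).symm
  · congr 1; exact filter_congr fun g _ => (key2 _ _).symm

/-- `fires` is additive over a disjoint family. -/
theorem fires_biUnion (β : Fin N → Fin N → ZMod 3) (c : Fin N → ZMod 3) (x : Fin N → Bool) (s : Finset (Finset (Fin N)))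
    (hd : ∀ k ∈ s, ∀ k' ∈ s, k ≠ k' → Disjoint k k') :
    fires β c (s.biUnion id) x = ∑ k ∈ s, fires β c k x := by
  unfold fires
  rw [filter_biUnion, card_biUnion]
  · rfl
  · intro k hk k' hk' hne
    exact disjoint_filter_filter (hd k hk k' hk' hne)

/-- Under a uniform shift the part fires according to the shifted phase count. -/
theorem fires_shift (β : Fin N → Fin N → ZMod 3) (c : Fin N → ZMod 3) (x : Fin N → Bool) {k : Finset (Fin N)} {p : Fin N × Fin N}
    {δ : ZMod 3} (hs : UniformShift β x k p δ) :
    fires β c k (flipAt x ({p.1, p.2} : Finset (Fin N))) = phaseCount β c x k δ := by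
  unfold fires phaseCount
  congr 1
  refine filter_congr fun g hg => ?_
  rw [hs g hg]

/-- A non-cut odd point keeps its ACTIVE FIRING PARITY under every coin-pair flip (`targetFormula` + `kline_flipPair`). -/
theorem fires_flip (hN : 3 ≤ N) (β : Fin N → Fin N → ZMod 3) (c : Fin N → ZMod 3) {x : Fin N → Bool} (hx : IsOdd x)
    (hnc : x ∉ cutPoints β c) {p : Fin N × Fin N} (hp : IsCoinPair x p) :
    fires β c (act x) x % 2 = fires β c (act x) (flipAt x ({p.1, p.2} : Finset (Fin N))) % 2 := by
  obtain ⟨hi, hj, hij⟩ := hp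
  have hi' : kline x p.1 = false := by rw [klineZeros, mem_filter] at hi; exact hi.2
  have hj' : kline x p.2 = false := by rw [klineZeros, mem_filter] at hj; exact hj.2
  obtain ⟨hodd', hk⟩ := kline_flipPair hN x hx hij hi' hj'
  set x' := flipAt x ({p.1, p.2} : Finset (Fin N)) with hx'
  have hrel : (RingHLF.Rel x (affBell β c x) ↔ RingHLF.Rel x' (affBell β c x')) := by
    by_contra h
    apply hnc
    rw [cutPoints, mem_filter]
    exact ⟨mem_univ _, hx, p.1, hi, p.2, hj, hij, h⟩
  have h1 := targetFormula N hN x hx (affBell β c x)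
  have h2 := targetFormula N hN x' hodd' (affBell β c x')
  rw [activeOnes_affBell β c rfl] at h1
  rw [activeOnes_affBell β c hk, hk] at h2
  rw [h1, h2] at hrel
  omega

/-! ### §C.3 The engine: certificate shape at a non-cut point forces wide parity (PROVED) -/

/-- **ENGINE (PROVED): `x ∉ cutPoints ∧ CertShapeW W ⇒ DesigParityAt W`** for every designated `W ⊆ act x` (radius one; no
private pairs). -/
theorem desigParity_of_cert (hN : 3 ≤ N) {W : Finset (Fin N)} (β : Fin N → Fin N → ZMod 3) (c : Fin N → ZMod 3) {x : Fin N → Bool}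
    (hWa : W ⊆ act x) (hx : IsOdd x) (hnc : x ∉ cutPoints β c) (h : CertShapeW W β x) : DesigParityAt W β c x := by
  obtain ⟨s, P, δ, hd, hU, href, hP, hsh, hcert⟩ := h
  -- shorthand: phase counts and their mod-2 differences
  set pc : Finset (Fin N) → ZMod 3 → ℕ := fun k t => phaseCount β c x k t with hpc
  have two0 : ∀ z : ZMod 2, z + z = 0 := by decide
  let A : Finset (Fin N) → ZMod 2 := fun k => (pc k 1 : ZMod 2) + (pc k 0 : ZMod 2)
  let B : Finset (Fin N) → ZMod 2 := fun k => (pc k 2 : ZMod 2) + (pc k 0 : ZMod 2)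
  -- (1) case analysis of a single shift
  have h01 : (0 : ZMod 3) ≠ 1 := by decide
  have h02 : (0 : ZMod 3) ≠ 2 := by decide
  have h12 : (1 : ZMod 3) ≠ 2 := by decide
  have h21 : (2 : ZMod 3) ≠ 1 := by decide
  have hcase : ∀ k : Finset (Fin N), ∀ t : ZMod 3,
      (pc k t : ZMod 2) + (pc k 0 : ZMod 2) = (if t = 1 then A k else 0) + (if t = 2 then B k else 0) := by
    intro k t
    have ht : t = 0 ∨ t = 1 ∨ t = 2 := by
      fin_cases t
      · exact Or.inl rfl
      · exact Or.inr (Or.inl rfl)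
      · exact Or.inr (Or.inr rfl)
    rcases ht with rfl | rfl | rfl
    · rw [if_neg h01, if_neg h02, add_zero, two0]
    · rw [if_pos rfl, if_neg h12, add_zero]
    · rw [if_neg h21, if_pos rfl, zero_add]
  -- (2) each pair of P: the active firing parity is unchanged, i.e. Σ_k (pc k (δ k p) + pc k 0) = 0 in ZMod 2
  have hpair : ∀ p ∈ P, ∑ k ∈ s, ((if δ k p = 1 then A k else 0) + (if δ k p = 2 then B k else 0)) = 0 := by
    intro p hp
    have hflip := fires_flip hN β c hx hnc (hP p hp)
    rw [← hU, fires_biUnion β c x s hd, fires_biUnion β c _ s hd] at hflip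
    have e1 : ∑ k ∈ s, fires β c k (flipAt x ({p.1, p.2} : Finset (Fin N))) = ∑ k ∈ s, pc k (δ k p) :=
      sum_congr rfl fun k hk => fires_shift β c x (hsh k hk p hp)
    have e0 : ∑ k ∈ s, fires β c k x = ∑ k ∈ s, pc k 0 :=
      sum_congr rfl fun k _ => (phaseCount_zero β c x k).symm
    rw [e1, e0] at hflip
    have hz : ((∑ k ∈ s, pc k 0 : ℕ) : ZMod 2) = ((∑ k ∈ s, pc k (δ k p) : ℕ) : ZMod 2) :=
      (ZMod.natCast_eq_natCast_iff' _ _ 2).2 hflip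
    push_cast at hz
    calc ∑ k ∈ s, ((if δ k p = 1 then A k else 0) + (if δ k p = 2 then B k else 0))
        = ∑ k ∈ s, ((pc k (δ k p) : ZMod 2) + (pc k 0 : ZMod 2)) := sum_congr rfl fun k _ => (hcase k (δ k p)).symm
      _ = ∑ k ∈ s, (pc k (δ k p) : ZMod 2) + ∑ k ∈ s, (pc k 0 : ZMod 2) := sum_add_distrib
      _ = 0 := by rw [← hz, two0]
  -- (3) sum over P, swap, and use the certificate parities: Σ_k T k * (A k + B k) = 0
  have hsumP : ∀ k ∈ s, ∑ p ∈ P, ((if δ k p = 1 then A k else 0) + (if δ k p = 2 then B k else 0)) = (if k ⊆ W then (1 : ZMod 2) else 0) * (A k + B k) := by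
    intro k hk
    rw [sum_add_distrib, ← sum_filter, ← sum_filter, sum_const, sum_const, nsmul_eq_mul, nsmul_eq_mul,
      (hcert k hk).1, (hcert k hk).2]
    ring
  have hstar : ∑ k ∈ s, (if k ⊆ W then (1 : ZMod 2) else 0) * (A k + B k) = 0 := by
    have h0 : ∑ p ∈ P, ∑ k ∈ s, ((if δ k p = 1 then A k else 0) + (if δ k p = 2 then B k else 0)) = 0 :=
      sum_eq_zero fun p hp => hpair p hp
    rw [sum_comm] at h0
    exact ((sum_congr rfl fun k hk => hsumP k hk).symm).trans h0
  -- (4) pc k 0 ≡ |k| + A k + B k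
  have hpc0 : ∀ k : Finset (Fin N), (pc k 0 : ZMod 2) = (k.card : ZMod 2) + A k + B k := by
    intro k
    have hsum' : pc k 0 + pc k 1 + pc k 2 = k.card := phaseCount_sum β c x k
    have hsum : (pc k 0 : ZMod 2) + (pc k 1 : ZMod 2) + (pc k 2 : ZMod 2) = (k.card : ZMod 2) := by
      have h := congrArg (Nat.cast : ℕ → ZMod 2) hsum'
      push_cast at h
      exact h
    have hkk := two0 (k.card : ZMod 2)
    have hk0 := two0 (pc k 0 : ZMod 2)
    have hk1 := two0 (pc k 1 : ZMod 2)
    have hk2 := two0 (pc k 2 : ZMod 2)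
    show (pc k 0 : ZMod 2) = (k.card : ZMod 2) + ((pc k 1 : ZMod 2) + (pc k 0 : ZMod 2)) + ((pc k 2 : ZMod 2) + (pc k 0 : ZMod 2))
    linear_combination hsum - hk0 - hk1 - hk2
  -- (5) W is the union of the wide parts
  set sW := s.filter fun k => k ⊆ W with hsW
  have hdW : ∀ k ∈ sW, ∀ k' ∈ sW, k ≠ k' → Disjoint k k' := fun k hk k' hk' hne =>
    hd k (mem_filter.1 hk).1 k' (mem_filter.1 hk').1 hne
  have hWU : sW.biUnion id = W := by
    apply Subset.antisymm
    · intro g hg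
      rw [mem_biUnion] at hg
      obtain ⟨k, hk, hgk⟩ := hg
      exact (mem_filter.1 hk).2 hgk
    · intro g hg
      have hga : g ∈ act x := hWa hg
      rw [← hU, mem_biUnion] at hga
      obtain ⟨k, hk, hgk⟩ := hga
      rw [mem_biUnion]
      refine ⟨k, mem_filter.2 ⟨hk, ?_⟩, hgk⟩
      rcases href k hk with h | h
      · exact h
      · exact absurd hg (disjoint_left.1 h hgk)
  -- (6) assemble
  unfold DesigParityAt
  apply (ZMod.natCast_eq_natCast_iff' _ _ 2).1
  have hfW : fires β c W x = ∑ k ∈ sW, pc k 0 := by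
    rw [← hWU, fires_biUnion β c x sW hdW]
    exact sum_congr rfl fun k _ => (phaseCount_zero β c x k).symm
  have hcW : W.card = ∑ k ∈ sW, k.card := by
    rw [← hWU]
    exact card_biUnion hdW
  rw [hfW, hcW]
  push_cast
  have hAB : ∑ k ∈ sW, (A k + B k) = 0 := by
    rw [hsW, sum_filter]
    refine Eq.trans (sum_congr rfl fun k _ => ?_) hstar
    split_ifs <;> ring
  calc ∑ k ∈ sW, (pc k 0 : ZMod 2) = ∑ k ∈ sW, ((k.card : ZMod 2) + (A k + B k)) :=
        sum_congr rfl fun k _ => by rw [hpc0 k, add_assoc]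
    _ = ∑ k ∈ sW, (k.card : ZMod 2) + ∑ k ∈ sW, (A k + B k) := sum_add_distrib
    _ = ∑ k ∈ sW, (k.card : ZMod 2) := by rw [hAB, add_zero]

/-- The width-threshold instance of the engine (record only, §C.6). -/
theorem wideParity_of_cert (hN : 3 ≤ N) (w : ℕ) (β : Fin N → Fin N → ZMod 3) (c : Fin N → ZMod 3) {x : Fin N → Bool}
    (hx : IsOdd x) (hnc : x ∉ cutPoints β c) (h : CertShape w β x) : WideParityAt w β c x :=
  desigParity_of_cert hN β c (fun _ hg => (mem_filter.1 hg).1) hx hnc h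

/-- **POINT COUNT (PROVED):** `#{x odd : ¬WideParityAt w} ≤ #{x odd : ¬CertShape w} + #cutPoints`. -/
theorem card_not_wideParity_le_cert (hN : 3 ≤ N) (w : ℕ) (β : Fin N → Fin N → ZMod 3) (c : Fin N → ZMod 3) :
    (univ.filter fun x : Fin N → Bool => IsOdd x ∧ ¬ WideParityAt w β c x).card
      ≤ (univ.filter fun x : Fin N → Bool => IsOdd x ∧ ¬ CertShape w β x).card + (cutPoints β c).card := by
  refine le_trans (card_le_card ?_) (card_union_le _ _)
  intro x hx
  rw [mem_filter] at hx
  rw [mem_union, mem_filter]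
  by_cases hsh : CertShape w β x
  · by_cases hcut : x ∈ cutPoints β c
    · exact Or.inr hcut
    · exact absurd (wideParity_of_cert hN w β c hx.2.1 hcut hsh) hx.2.2
  · exact Or.inl ⟨mem_univ _, hx.2.1, hsh⟩


end AffBells30

end Summit.QuantumAdvantage.AdviceFreeQNC0
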